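import Mathlib
import Literature.NumberTheory.Transcendental.CubeChartMonomial
import HarnessLib

/-!
# Toric charts of the cube: the Jacobian formula and the integrability test

Solo programme `solo-KontsevichZagierPeriods-informed`, session s103, line "toric sector of the
cube crux" (THEOREM T, `SoloInformedToricSector.lean`). Two analytic inputs for the monomial
(toric) charts `μ_A(v)ᵢ = ∏ⱼ vⱼ^{A i j}` of an exponent matrix `A ∈ ℕ^{n×n}` (Fulton 1993, §2.6, in
multiplicative coordinates; the Literature file `CubeChartMonomial.lean` records `det Dμ_A ≠ 0`
only):

* `soloInformed_hasFDerivAt_monomialMap`, `soloInformed_abs_det_monoD` — the **Jacobian formula**: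
  `Dμ_A(v)` is the matrix `(A i j · vⱼ^{A i j − 1} · ∏_{k ≠ j} v_k^{A i k})ᵢⱼ`, equal to
  `diag(μ_A v) · A · diag(v)⁻¹` off the coordinate hyperplanes, whence
  `|det Dμ_A(v)| = |det A| · (∏ⱼ vⱼ^{Σᵢ A i j}) / ∏ⱼ vⱼ` for `v` with positive coordinates;
* `soloInformed_le_of_integrableOn_monomialRatio` — the **integrability test**: if
  `v ↦ v^u / v^w` (`u, w ∈ ℕⁿ`) is integrable on the open cube `(0,1)ⁿ` then `w ≤ u` componentwise
  (Fubini over the sub-box `∏_{k ≠ j} (½,1) × (t,1)` and `∫_t^1 dx/x = log(1/t) → ∞`).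

References: W. Fulton, *Introduction to Toric Varieties* (1993), §2.6; M. Kontsevich, D. Zagier,
*Periods* (2001), §1.2.
-/

noncomputable section

open scoped BigOperators
open MeasureTheory Set

namespace Summit.KontsevichZagierPeriods.KontsevichZagierPeriods.Theorems

variable {n : ℕ}

/-! ### The Jacobian matrix of a monomial map -/

/-- The Jacobian matrix of `μ_A` at `v`:
`∂ⱼ (∏ₖ v_k^{A i k}) = A i j · vⱼ^{A i j − 1} · ∏_{k ≠ j} v_k^{A i k}`. [this work] -/
def soloInformedMonoJac (A : Matrix (Fin n) (Fin n) ℕ) (v : Fin n → ℝ) :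
    Matrix (Fin n) (Fin n) ℝ :=
  fun i j => (A i j : ℝ) * v j ^ (A i j - 1) * ∏ k ∈ Finset.univ.erase j, v k ^ A i k

/-- The derivative of `μ_A` at `v`, as a continuous linear map. [this work] -/
def soloInformedMonoD (A : Matrix (Fin n) (Fin n) ℕ) (v : Fin n → ℝ) :
    (Fin n → ℝ) →L[ℝ] (Fin n → ℝ) :=
  LinearMap.toContinuousLinearMap (Matrix.toLin' (soloInformedMonoJac A v))

/-- `Dμ_A(v) w` in coordinates. [this work] -/
theorem soloInformedMonoD_apply (A : Matrix (Fin n) (Fin n) ℕ) (v w : Fin n → ℝ) (i : Fin n) :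
    soloInformedMonoD A v w i = ∑ j, soloInformedMonoJac A v i j * w j := by
  change Matrix.toLin' (soloInformedMonoJac A v) w i = _
  rw [Matrix.toLin'_apply]
  simp [Matrix.mulVec, dotProduct]

/-- **The monomial map `μ_A` has derivative `Dμ_A(v)` at every point.** [this work] -/
theorem soloInformed_hasFDerivAt_monomialMap (A : Matrix (Fin n) (Fin n) ℕ) (v : Fin n → ℝ) :
    HasFDerivAt (fun (v : Fin n → ℝ) (i : Fin n) => ∏ j, v j ^ A i j)
      (soloInformedMonoD A v) v := by
  rw [hasFDerivAt_pi']
  intro i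
  have hg : ∀ j ∈ (Finset.univ : Finset (Fin n)),
      HasFDerivAt (fun x : Fin n → ℝ => x j ^ A i j)
        (((A i j : ℕ) • v j ^ (A i j - 1)) •
          ContinuousLinearMap.proj (R := ℝ) (φ := fun _ : Fin n => ℝ) j) v :=
    fun j _ => (hasFDerivAt_apply j v).pow (A i j)
  have h := HasFDerivAt.finsetProd (u := Finset.univ)
    (g := fun (j : Fin n) (x : Fin n → ℝ) => x j ^ A i j) hg
  refine h.congr_fderiv (ContinuousLinearMap.ext fun w => ?_)
  simp only [_root_.sum_apply, _root_.smul_apply,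
    ContinuousLinearMap.proj_apply, smul_eq_mul, nsmul_eq_mul, ContinuousLinearMap.comp_apply,
    soloInformedMonoD_apply]
  exact Finset.sum_congr rfl fun j _ => by unfold soloInformedMonoJac; ring

/-- The derivative within any set. [this work] -/
theorem soloInformed_hasFDerivWithinAt_monomialMap (A : Matrix (Fin n) (Fin n) ℕ)
    (s : Set (Fin n → ℝ)) (v : Fin n → ℝ) :
    HasFDerivWithinAt (fun (v : Fin n → ℝ) (i : Fin n) => ∏ j, v j ^ A i j)
      (soloInformedMonoD A v) s v :=
  (soloInformed_hasFDerivAt_monomialMap A v).hasFDerivWithinAt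

/-- Off the coordinate hyperplanes, `(Dμ_A(v))ᵢⱼ = (μ_A v)ᵢ · A i j / vⱼ`. [this work] -/
theorem soloInformedMonoJac_apply_of_ne (A : Matrix (Fin n) (Fin n) ℕ) {v : Fin n → ℝ}
    (hv : ∀ j, v j ≠ 0) (i j : Fin n) :
    soloInformedMonoJac A v i j = (∏ k, v k ^ A i k) * (A i j : ℝ) * (v j)⁻¹ := by
  unfold soloInformedMonoJac
  rcases Nat.eq_zero_or_pos (A i j) with h | h
  · simp [h]
  · rw [← Finset.mul_prod_erase Finset.univ (fun k => v k ^ A i k) (Finset.mem_univ j)]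
    have hp : v j ^ A i j = v j * v j ^ (A i j - 1) := by
      rw [← pow_succ', Nat.sub_add_cancel h]
    rw [hp]
    have hvj := hv j
    field_simp

/-- Off the coordinate hyperplanes, `Dμ_A(v) = diag(μ_A v) · A · diag(v)⁻¹`. [this work] -/
theorem soloInformedMonoJac_eq_of_ne (A : Matrix (Fin n) (Fin n) ℕ) {v : Fin n → ℝ}
    (hv : ∀ j, v j ≠ 0) :
    soloInformedMonoJac A v = Matrix.diagonal (fun i => ∏ k, v k ^ A i k) *
      A.map (fun t : ℕ => (t : ℝ)) * Matrix.diagonal (fun j => (v j)⁻¹) := by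
  ext i j
  rw [Matrix.mul_diagonal, Matrix.diagonal_mul, Matrix.map_apply,
    soloInformedMonoJac_apply_of_ne A hv]

/-- **Jacobian determinant of a monomial map**:
`det Dμ_A(v) = det A · (∏ⱼ vⱼ^{Σᵢ A i j}) · ∏ⱼ vⱼ⁻¹` off the coordinate hyperplanes. [this work] -/
theorem soloInformedMonoD_det_of_ne (A : Matrix (Fin n) (Fin n) ℕ) {v : Fin n → ℝ}
    (hv : ∀ j, v j ≠ 0) :
    (soloInformedMonoD A v).det =
      (A.map (fun t : ℕ => (t : ℝ))).det * ((∏ j, v j ^ (∑ i, A i j)) * ∏ j, (v j)⁻¹) := by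
  change LinearMap.det (Matrix.toLin' (soloInformedMonoJac A v)) = _
  rw [LinearMap.det_toLin', soloInformedMonoJac_eq_of_ne A hv, Matrix.det_mul, Matrix.det_mul,
    Matrix.det_diagonal, Matrix.det_diagonal]
  have h : (∏ i, ∏ k, v k ^ A i k) = ∏ j, v j ^ (∑ i, A i j) := by
    rw [Finset.prod_comm]
    exact Finset.prod_congr rfl fun j _ => Finset.prod_pow_eq_pow_sum _ _ _
  rw [h]
  ring

/-- **The Jacobian formula**: `|det Dμ_A(v)| = |det A| · (∏ⱼ vⱼ^{Σᵢ A i j}) / ∏ⱼ vⱼ` on the open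
positive orthant. [this work] -/
theorem soloInformed_abs_det_monoD (A : Matrix (Fin n) (Fin n) ℕ) {v : Fin n → ℝ}
    (hv : ∀ j, 0 < v j) :
    |(soloInformedMonoD A v).det| =
      |(A.map (fun t : ℕ => (t : ℝ))).det| * ((∏ j, v j ^ (∑ i, A i j)) / ∏ j, v j) := by
  rw [soloInformedMonoD_det_of_ne A (fun j => (hv j).ne'), abs_mul, Finset.prod_inv_distrib,
    ← div_eq_mul_inv]
  congr 1
  exact abs_of_pos (div_pos (Finset.prod_pos fun j _ => pow_pos (hv j) _)
    (Finset.prod_pos fun j _ => hv j))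

/-! ### The integrability test for monomial ratios on the open cube -/

/-- `x ↦ x^u / x^w` is continuous on `[a, 1]` for `a > 0`. [this work] -/
theorem soloInformed_continuousOn_powRatio (u w : ℕ) {a : ℝ} (ha : 0 < a) :
    ContinuousOn (fun x : ℝ => x ^ u / x ^ w) (Icc a 1) :=
  (continuousOn_pow u).div (continuousOn_pow w) fun _ hx => pow_ne_zero _ (ha.trans_le hx.1).ne'

/-- `x ↦ x^u / x^w` is integrable on `(a, 1)` for `a > 0`. [this work] -/
theorem soloInformed_integrableOn_powRatio (u w : ℕ) {a : ℝ} (ha : 0 < a) :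
    IntegrableOn (fun x : ℝ => x ^ u / x ^ w) (Ioo a 1) :=
  ((soloInformed_continuousOn_powRatio u w ha).integrableOn_Icc).mono_set Ioo_subset_Icc_self

/-- `∫_{(½,1)} x^u / x^w ≥ (½)^u · ½ > 0`. [this work] -/
theorem soloInformed_half_pow_le_integral (u w : ℕ) :
    (1 / 2 : ℝ) ^ u * (1 / 2) ≤ ∫ x in Ioo (1 / 2 : ℝ) 1, x ^ u / x ^ w := by
  have hc : ∫ _ in Ioo (1 / 2 : ℝ) 1, (1 / 2 : ℝ) ^ u = (1 / 2 : ℝ) ^ u * (1 / 2) := by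
    rw [setIntegral_const, Real.volume_real_Ioo_of_le (by norm_num), smul_eq_mul]
    ring
  rw [← hc]
  refine setIntegral_mono_on (integrableOn_const (by simp))
    (soloInformed_integrableOn_powRatio u w (by norm_num)) measurableSet_Ioo fun x hx => ?_
  have hx0 : 0 < x := by linarith [hx.1]
  rw [le_div_iff₀ (pow_pos hx0 _)]
  calc (1 / 2 : ℝ) ^ u * x ^ w ≤ (1 / 2) ^ u * 1 :=
        mul_le_mul_of_nonneg_left (pow_le_one₀ hx0.le hx.2.le) (by positivity)
    _ ≤ x ^ u := by rw [mul_one]; exact pow_le_pow_left₀ (by norm_num) hx.1.le u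

/-- `∫_{(t,1)} x^u / x^w ≥ log(1/t)` when `u < w` and `0 < t ≤ 1`. [this work] -/
theorem soloInformed_log_le_integral {u w : ℕ} (huw : u < w) {t : ℝ} (ht : 0 < t) (ht1 : t ≤ 1) :
    Real.log (1 / t) ≤ ∫ x in Ioo t 1, x ^ u / x ^ w := by
  have hinv : ∫ x in Ioo t 1, x⁻¹ = Real.log (1 / t) := by
    rw [← integral_Ioc_eq_integral_Ioo, ← intervalIntegral.integral_of_le ht1,
      integral_inv_of_pos ht one_pos]
  rw [← hinv]
  have hi : IntegrableOn (fun x : ℝ => x⁻¹) (Ioo t 1) :=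
    ((continuousOn_id.inv₀ fun x hx => (ht.trans_le hx.1).ne').integrableOn_Icc).mono_set
      Ioo_subset_Icc_self
  refine setIntegral_mono_on hi (soloInformed_integrableOn_powRatio u w ht) measurableSet_Ioo
    fun x hx => ?_
  have hx0 : 0 < x := ht.trans hx.1
  rw [inv_eq_one_div, div_le_div_iff₀ hx0 (pow_pos hx0 _), one_mul]
  have hsplit : x ^ w = x ^ u * x ^ (w - u) := by rw [← pow_add, Nat.add_sub_cancel' huw.le]
  rw [hsplit]
  exact mul_le_mul_of_nonneg_left (pow_le_of_le_one hx0.le hx.2.le (Nat.sub_ne_zero_of_lt huw))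
    (pow_nonneg hx0.le _)

/-- **Integrability test.** If `v ↦ (∏ⱼ vⱼ^{uⱼ}) / ∏ⱼ vⱼ^{wⱼ}` is integrable on the open cube
`(0,1)ⁿ`, then `wⱼ ≤ uⱼ` for every `j`: otherwise Fubini over the box
`∏_{k ≠ j} (½,1) × (t,1) ⊆ (0,1)ⁿ` bounds the integral below by `c · log(1/t)` with `c > 0`,
unbounded as `t → 0`. [this work] -/
theorem soloInformed_le_of_integrableOn_monomialRatio (u w : Fin n → ℕ)
    (h : IntegrableOn (fun v : Fin n → ℝ => (∏ j, v j ^ u j) / ∏ j, v j ^ w j)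
      (Set.pi univ fun _ : Fin n => Ioo (0 : ℝ) 1)) (j : Fin n) : w j ≤ u j := by
  classical
  by_contra hlt
  push Not at hlt
  -- the data
  have hmeasC : MeasurableSet (Set.pi univ fun _ : Fin n => Ioo (0 : ℝ) 1) :=
    MeasurableSet.univ_pi fun _ => measurableSet_Ioo
  have hfnn : ∀ v ∈ Set.pi univ (fun _ : Fin n => Ioo (0 : ℝ) 1),
      0 ≤ (∏ j, v j ^ u j) / ∏ j, v j ^ w j := fun v hv =>
    div_nonneg (Finset.prod_nonneg fun k _ => pow_nonneg ((mem_univ_pi.1 hv) k).1.le _)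
      (Finset.prod_nonneg fun k _ => pow_nonneg ((mem_univ_pi.1 hv) k).1.le _)
  have hI0 : 0 ≤ ∫ v in Set.pi univ (fun _ : Fin n => Ioo (0 : ℝ) 1),
      (∏ j, v j ^ u j) / ∏ j, v j ^ w j := setIntegral_nonneg hmeasC hfnn
  obtain ⟨I, hI⟩ : ∃ I : ℝ, I = ∫ v in Set.pi univ (fun _ : Fin n => Ioo (0 : ℝ) 1),
      (∏ j, v j ^ u j) / ∏ j, v j ^ w j := ⟨_, rfl⟩
  rw [← hI] at hI0
  obtain ⟨c, hc⟩ : ∃ c : ℝ, c = ∏ k ∈ Finset.univ.erase j, (1 / 2 : ℝ) ^ u k * (1 / 2) :=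
    ⟨_, rfl⟩
  have hcpos : 0 < c := by rw [hc]; exact Finset.prod_pos fun k _ => by positivity
  -- the parameter `t` with `c · log(1/t) = I + 1`
  obtain ⟨t, ht⟩ : ∃ t : ℝ, t = Real.exp (-((I + 1) / c)) := ⟨_, rfl⟩
  have ht0 : 0 < t := by rw [ht]; exact Real.exp_pos _
  have ht1 : t ≤ 1 := by
    rw [ht, Real.exp_le_one_iff, neg_nonpos]
    exact div_nonneg (by linarith) hcpos.le
  have hlog : Real.log (1 / t) = (I + 1) / c := by
    rw [one_div, Real.log_inv, ht, Real.log_exp, neg_neg]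
  -- the box
  obtain ⟨lo, hlo⟩ : ∃ lo : Fin n → ℝ, lo = fun k => if k = j then t else 1 / 2 := ⟨_, rfl⟩
  have hloj : lo j = t := by rw [hlo]; simp
  have hlok : ∀ k, k ≠ j → lo k = 1 / 2 := fun k hk => by rw [hlo]; simp [hk]
  have hlo0 : ∀ k, 0 < lo k := by
    intro k
    by_cases hk : k = j
    · rw [hk, hloj]; exact ht0
    · rw [hlok k hk]; norm_num
  have hBC : (Set.pi univ fun k => Ioo (lo k) 1) ⊆ Set.pi univ fun _ : Fin n => Ioo (0 : ℝ) 1 :=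
    Set.pi_mono fun k _ => Ioo_subset_Ioo_left (hlo0 k).le
  -- Fubini over the box
  have hprod : ∫ v in Set.pi univ (fun k => Ioo (lo k) 1), (∏ j, v j ^ u j) / ∏ j, v j ^ w j =
      ∏ k, ∫ x in Ioo (lo k) 1, x ^ u k / x ^ w k := by
    have hm : (volume : Measure (Fin n → ℝ)).restrict (Set.pi univ fun k => Ioo (lo k) 1) =
        Measure.pi (fun k => (volume : Measure ℝ).restrict (Ioo (lo k) 1)) := by
      rw [volume_pi, Measure.restrict_pi_pi]
    have hf : (fun v : Fin n → ℝ => (∏ j, v j ^ u j) / ∏ j, v j ^ w j) =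
        fun v => ∏ k, (fun (k : Fin n) (x : ℝ) => x ^ u k / x ^ w k) k (v k) := by
      funext v
      exact (Finset.prod_div_distrib _ _).symm
    rw [hm, hf]
    exact integral_fintype_prod_eq_prod (fun (k : Fin n) (x : ℝ) => x ^ u k / x ^ w k)
  -- lower bound
  have hlow : c * Real.log (1 / t) ≤
      ∫ v in Set.pi univ (fun k => Ioo (lo k) 1), (∏ j, v j ^ u j) / ∏ j, v j ^ w j := by
    rw [hprod, ← Finset.mul_prod_erase Finset.univ _ (Finset.mem_univ j), mul_comm c, hloj]
    have hj : Real.log (1 / t) ≤ ∫ x in Ioo t 1, x ^ u j / x ^ w j :=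
      soloInformed_log_le_integral hlt ht0 ht1
    refine mul_le_mul hj ?_ hcpos.le ((Real.log_nonneg (by
      rw [le_div_iff₀ ht0, one_mul]; exact ht1)).trans hj)
    rw [hc]
    refine Finset.prod_le_prod (fun k _ => by positivity) fun k hk => ?_
    rw [hlok k (Finset.ne_of_mem_erase hk)]
    exact soloInformed_half_pow_le_integral (u k) (w k)
  -- upper bound
  have hup : ∫ v in Set.pi univ (fun k => Ioo (lo k) 1), (∏ j, v j ^ u j) / ∏ j, v j ^ w j ≤ I := by
    rw [hI]
    exact setIntegral_mono_set h (ae_restrict_of_forall_mem hmeasC hfnn) hBC.eventuallyLE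
  -- contradiction
  rw [hlog, mul_div_cancel₀ _ hcpos.ne'] at hlow
  linarith

end Summit.KontsevichZagierPeriods.KontsevichZagierPeriods.Theorems
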